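import Summits.ValiantsHypothesis.ValiantsHypothesis.Theorems.GrenetZeonDualUnipotentThreeHalvesLongMassLedgerTorus

/-!
# PART VIII-a (Möbius operator, finite exponentials, the families `Φm`, `Nfam`, `scl`) — Theorems-side port of val-idea-28 g5's staged `…LongMassLedgerBorel.lean` (sha16 778689f35a337204, 681 l.; Parts VIII–IX of
# `Cruxes/DualUnipotentThreeHalves/InitialForm.lean` rev 14 @11411eb80f60; crit-7 V40 «CORRECT INSTRUMENT», V36 §B; desk val-lit #420 «port-3's next»)

PORT NOTE.  Decl texts VERBATIM BY NAME, namespaces as staged (`…InitialForm.UnipotentClosure` / `.LedgerUnipotent`); the ONLY changes are the 400-line-cap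
SPLIT into three chained modules `GrenetZeonDualUnipotentThreeHalvesLongMassLedgerBorel{Family, Closure, ∅}.lean` (this file imports ✓ `…LongMassLedgerTorus` (p688303); the `UnipotentClosure` namespace is re-opened in
`…Closure.lean` with the same `open`s and `variable {ι} [Fintype ι] [DecidableEq ι] {K}` context), these headers, and one-line docstrings where the gate's
`lint.docstring` requires them.  `--supports stmt-ValiantsHypothesis-24318` helper.  ALL CREDIT: val-idea-28 g5.  HONEST STATUS (author's): INSTRUMENT — the
normal form of (c)-certificates under a unipotent symmetry normalised by a torus; proves NO case of (c) `SlowCore.LongMassSlowLawInv`, NOT progress on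
(c); 24318 OPEN; VP ≠ VNP is NOT proved.  The author's full module docstring is reproduced in `GrenetZeonDualUnipotentThreeHalvesLongMassLedgerBorelFamily.lean`.
-/

/-! AUTHOR'S MODULE DOCSTRING (val-idea-28 g5, verbatim):
# Borel normal form of `RelCert` certificates — unipotent closure and the JOINT (T ⋉ U) normal form (instrument; by name)

Provenance: verbatim port of Parts VIII–IX of `Cruxes/DualUnipotentThreeHalves/InitialForm.lean` rev 14 (val-idea-28 g5; crit-7 V40 «CORRECT INSTRUMENT»,
V36 §B).  HONEST STATUS: VP ≠ VNP is NOT proved; crux 24318 and (c) `SlowCore.LongMassSlowLawInv` are OPEN; this file proves NO case of (c) and is NOT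
progress on (c): it is the normal form of (c)-certificates under a unipotent symmetry normalised by a torus — hypotheses (`TorusEquivariant`,
`LinEquivariant N (exp (u • A))`, `hcomp`) to be exhibited per candidate pencil (the gauge pencil `W(b)` has only the torus half).  `--supports
stmt-ValiantsHypothesis-24318 --as helper`.

CONTENTS: PART VIII (`UnipotentClosure`, Mathlib + Part III): `mob`/`mob_eval` (Möbius reparametrisation), `Φm`, `Nfam`, `exists_stable_of_expStable_core`,
`exists_stable_of_expStable`; PART IX: `graded_of_torusStable`, ★★ `exists_graded_stable`; by name (`LedgerUnipotent`, vs ✓ `SlowCore.Ledger`/`RelCert`):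
`LinEquivariant`, `windowCone_linAct`, ★★ `ledger_stable_of_unipotentEquivariant`, `relCert_stable_of_unipotentEquivariant`, ★★ `ledger_borel_of_equivariant`,
★★ `relCert_borel_of_equivariant`.
-/

set_option linter.dupNamespace false

noncomputable section

/-! # PART VIII — UNIPOTENT CLOSURE: certificates may be taken stable under a unipotent symmetry -/

namespace Summit.ValiantsHypothesis.ValiantsHypothesis.Theorems.GrenetZeon.InitialForm.UnipotentClosure

open Summit.ValiantsHypothesis.ValiantsHypothesis.Theorems.GrenetZeon.InitialForm.CurveClosure Matrix
open scoped Nat Polynomial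

variable {ι : Type*} [Fintype ι] [DecidableEq ι]

/-! ### The polynomial Möbius operator `p ↦ (1 + u s)^E · p (s / (1 + u s))` -/

/-- `mob u E p = ∑ᵢ pᵢ sⁱ (1 + u s)^{E-i}` (= `(1 + u s)^E · p(s/(1+us))` when `natDegree p ≤ E`). -/
noncomputable def mob (u : ℂ) (E : ℕ) (p : ℂ[X]) : ℂ[X] :=
  ∑ i ∈ Finset.range (E + 1), Polynomial.C (p.coeff i) * Polynomial.X ^ i * (1 + Polynomial.C u * Polynomial.X) ^ (E - i)

/-- `mob_eval_zero` — helper of this port (see the module docstring for its role). (docstring added in the port) -/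
theorem mob_eval_zero (u : ℂ) (E : ℕ) (p : ℂ[X]) : (mob u E p).eval 0 = p.eval 0 := by
  rw [mob, Polynomial.eval_finsetSum, Finset.sum_eq_single 0]
  · simp [Polynomial.coeff_zero_eq_eval_zero]
  · intro i _ hi
    simp [zero_pow hi]
  · intro h; exact absurd (Finset.mem_range.mpr (Nat.succ_pos E)) h

/-- `mob_eval` — helper of this port (see the module docstring for its role). (docstring added in the port) -/
theorem mob_eval (u : ℂ) {E : ℕ} {p : ℂ[X]} (hp : p.natDegree ≤ E) {t : ℂ} (ht : 1 + u * t ≠ 0) :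
    (mob u E p).eval t = (1 + u * t) ^ E * p.eval (t / (1 + u * t)) := by
  rw [mob, Polynomial.eval_finsetSum, Polynomial.eval_eq_sum_range' (lt_of_le_of_lt hp (Nat.lt_succ_self E)) (t / (1 + u * t)),
    Finset.mul_sum]
  refine Finset.sum_congr rfl fun i hi => ?_
  have hiE : i ≤ E := Nat.lt_succ_iff.mp (Finset.mem_range.mp hi)
  simp only [Polynomial.eval_mul, Polynomial.eval_C, Polynomial.eval_pow, Polynomial.eval_X, Polynomial.eval_add,
    Polynomial.eval_one]
  rw [div_pow, ← pow_sub_mul_pow (1 + u * t) hiE]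
  field_simp

/-- Componentwise Möbius operator on polynomial vectors. -/
noncomputable def mobv (u : ℂ) (E : ℕ) (w : ι → ℂ[X]) : ι → ℂ[X] := fun e => mob u E (w e)

omit [Fintype ι] [DecidableEq ι] in
/-- `ev_zero_mobv` — helper of this port (see the module docstring for its role). (docstring added in the port) -/
theorem ev_zero_mobv (u : ℂ) (E : ℕ) (w : ι → ℂ[X]) : ev 0 (mobv u E w) = ev 0 w := by
  funext e; simp [mobv, mob_eval_zero]

omit [Fintype ι] [DecidableEq ι] in
/-- `ev_mobv` — helper of this port (see the module docstring for its role). (docstring added in the port) -/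
theorem ev_mobv (u : ℂ) {E : ℕ} {w : ι → ℂ[X]} (hw : ∀ e, (w e).natDegree ≤ E) {t : ℂ} (ht : 1 + u * t ≠ 0) :
    ev t (mobv u E w) = (1 + u * t) ^ E • ev (t / (1 + u * t)) w := by
  funext e; simp [mobv, mob_eval u (hw e) ht]

/-! ### Finite exponentials of a nilpotent matrix -/

/-- `exp (x A) = ∑_{i<N} xⁱ Aⁱ / i!` once `A ^ N = 0` (as in `Literature.NumberTheory.Automorphic.NilpotentExpRootHom`). -/
theorem exp_smul_eq_sum' {A : Matrix ι ι ℂ} {N : ℕ} (hN : A ^ N = 0) (x : ℂ) :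
    IsNilpotent.exp (x • A) = ∑ i ∈ Finset.range N, x ^ i • (((i ! : ℂ))⁻¹ • A ^ i) := by
  rw [IsNilpotent.exp_eq_sum (k := N) (by rw [smul_pow, hN, smul_zero])]
  refine Finset.sum_congr rfl fun i _ => ?_
  rw [smul_pow, smul_comm, ← algebraMap_smul ℂ ((i ! : ℚ)⁻¹), map_inv₀, map_natCast]

/-- `exp_smul_mul_exp_smul` — helper of this port (see the module docstring for its role). (docstring added in the port) -/
theorem exp_smul_mul_exp_smul {A : Matrix ι ι ℂ} (hA : IsNilpotent A) (a b : ℂ) :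
    IsNilpotent.exp (a • A) * IsNilpotent.exp (b • A) = IsNilpotent.exp ((a + b) • A) := by
  rw [add_smul]
  exact (IsNilpotent.exp_add_of_commute (((Commute.refl A).smul_left _).smul_right _) (hA.smul _) (hA.smul _)).symm

/-! ### The polynomial family `Φ = s^D · exp (A / s)` -/

/-- `Φm A D = ∑_{j ≤ D} (s^{D-j} / j!) · A^j`, a matrix over `ℂ[s]`. -/
noncomputable def Φm (A : Matrix ι ι ℂ) (D : ℕ) : Matrix ι ι ℂ[X] :=
  ∑ j ∈ Finset.range (D + 1), (Polynomial.C (((j ! : ℂ))⁻¹) * Polynomial.X ^ (D - j)) • (A.map Polynomial.C) ^ j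

omit [DecidableEq ι] in
/-- `ev_mulVec` — helper of this port (see the module docstring for its role). (docstring added in the port) -/
theorem ev_mulVec (t : ℂ) (M : Matrix ι ι ℂ[X]) (q : ι → ℂ[X]) : ev t (M *ᵥ q) = (M.map (Polynomial.eval t)) *ᵥ ev t q := by
  funext i
  exact (RingHom.map_mulVec (Polynomial.evalRingHom t) M q i :)

/-- `map_pow_eval` — helper of this port (see the module docstring for its role). (docstring added in the port) -/
theorem map_pow_eval (A : Matrix ι ι ℂ) (t : ℂ) (j : ℕ) : ((A.map Polynomial.C) ^ j).map (Polynomial.eval t) = A ^ j := by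
  have h := Matrix.map_pow (A.map Polynomial.C) (Polynomial.evalRingHom t) j
  rw [Polynomial.coe_evalRingHom] at h
  rw [h, Matrix.map_map]
  have : (Polynomial.eval t ∘ Polynomial.C : ℂ → ℂ) = id := funext fun c => Polynomial.eval_C
  rw [this, Matrix.map_id]

omit [Fintype ι] [DecidableEq ι] in
/-- `map_C_map_eval` — helper of this port (see the module docstring for its role). (docstring added in the port) -/
theorem map_C_map_eval (B : Matrix ι ι ℂ) (t : ℂ) : (B.map (Polynomial.C : ℂ → ℂ[X])).map (Polynomial.eval t) = B := by
  rw [Matrix.map_map]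
  have : (Polynomial.eval t ∘ Polynomial.C : ℂ → ℂ) = id := funext fun c => Polynomial.eval_C
  rw [this, Matrix.map_id]

/-- `ev_Φm_mulVec` — helper of this port (see the module docstring for its role). (docstring added in the port) -/
theorem ev_Φm_mulVec {A : Matrix ι ι ℂ} {D : ℕ} (hA : A ^ (D + 1) = 0) {t : ℂ} (ht : t ≠ 0) (q : ι → ℂ[X]) :
    ev t (Φm A D *ᵥ q) = t ^ D • (IsNilpotent.exp (t⁻¹ • A) *ᵥ ev t q) := by
  rw [ev_mulVec, ← Matrix.smul_mulVec]
  congr 1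
  rw [exp_smul_eq_sum' hA, Finset.smul_sum]
  refine Matrix.ext fun i k => ?_
  rw [Matrix.map_apply, Φm, Matrix.sum_apply, Polynomial.eval_finsetSum, Matrix.sum_apply]
  refine Finset.sum_congr rfl fun j hj => ?_
  have hjD : j ≤ D := Nat.lt_succ_iff.mp (Finset.mem_range.mp hj)
  have hpow := congrFun (congrFun (map_pow_eval A t j) i) k
  rw [Matrix.map_apply] at hpow
  rw [Matrix.smul_apply, smul_eq_mul, Polynomial.eval_mul, hpow, Matrix.smul_apply, Matrix.smul_apply, Matrix.smul_apply,
    smul_eq_mul, smul_eq_mul, smul_eq_mul, Polynomial.eval_mul, Polynomial.eval_C, Polynomial.eval_pow, Polynomial.eval_X,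
    pow_sub₀ _ ht hjD, inv_pow]
  ring

/-- `Φ` is injective on polynomial vectors. -/
theorem Φm_mulVec_injective {A : Matrix ι ι ℂ} {D : ℕ} (hA : A ^ (D + 1) = 0) {q : ι → ℂ[X]} (hq : Φm A D *ᵥ q = 0) :
    q = 0 := by
  classical
  by_contra hne
  set Ap : Matrix ι ι ℂ[X] := A.map Polynomial.C with hAp
  have hAp0 : Ap ^ (D + 1) = 0 := by
    rw [hAp, ← Matrix.map_pow, hA]
    ext i j; simp
  let S : Finset ℕ := (Finset.range (D + 1)).filter fun j => (Ap ^ j) *ᵥ q ≠ 0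
  have h0S : 0 ∈ S := Finset.mem_filter.mpr ⟨Finset.mem_range.mpr (Nat.succ_pos D), by simpa using hne⟩
  have hS : S.Nonempty := ⟨0, h0S⟩
  set a := S.max' hS with ha_def
  have haS := Finset.max'_mem S hS
  have ha : (Ap ^ a) *ᵥ q ≠ 0 := (Finset.mem_filter.mp haS).2
  have hgt : ∀ j, a < j → (Ap ^ j) *ᵥ q = 0 := by
    intro j hj
    by_cases hjD : j ≤ D
    · by_contra h
      have hjS : j ∈ S := Finset.mem_filter.mpr ⟨Finset.mem_range.mpr (Nat.lt_succ_of_le hjD), h⟩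
      exact absurd (S.le_max' j hjS) (not_le.mpr hj)
    · push Not at hjD
      rw [← pow_sub_mul_pow Ap (Nat.succ_le_of_lt hjD), hAp0, mul_zero, Matrix.zero_mulVec]
  have h1 : (Ap ^ a) *ᵥ (Φm A D *ᵥ q) = 0 := by rw [hq, Matrix.mulVec_zero]
  rw [Matrix.mulVec_mulVec, Φm, Finset.mul_sum, Matrix.sum_mulVec, Finset.sum_eq_single 0] at h1
  · rw [Matrix.mul_smul, pow_zero, mul_one, Matrix.smul_mulVec, smul_eq_zero] at h1
    rcases h1 with h1 | h1
    · simp at h1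
    · exact ha h1
  · intro j _ hj0
    rw [Matrix.mul_smul, ← pow_add, Matrix.smul_mulVec, hgt (a + j) (Nat.lt_add_of_pos_right (Nat.pos_of_ne_zero hj0)),
      smul_zero]
  · intro h; exact absurd (Finset.mem_range.mpr (Nat.succ_pos D)) h

/-! ### The algebraic family `N = Φ (K[s])` -/

variable (K : Submodule ℂ (ι → ℂ))

/-- Constant polynomial vectors on a basis of `K`. -/
noncomputable def κ (i : Fin (Module.finrank ℂ K)) : ι → ℂ[X] := fun e => Polynomial.C (((Module.finBasis ℂ K) i : ι → ℂ) e)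

/-- `K[s]`: the `ℂ[s]`-span of `K`. -/
noncomputable def Kpoly : Submodule ℂ[X] (ι → ℂ[X]) := Submodule.span ℂ[X] (Set.range (κ K))

omit [DecidableEq ι] in
/-- `ev_κ` — helper of this port (see the module docstring for its role). (docstring added in the port) -/
theorem ev_κ (t : ℂ) (i : Fin (Module.finrank ℂ K)) : ev t (κ K i) = ((Module.finBasis ℂ K) i : ι → ℂ) := by
  funext e; simp [κ]

omit [Fintype ι] [DecidableEq ι] in
/-- `ev_zero'` — helper of this port (see the module docstring for its role). (docstring added in the port) -/
theorem ev_zero' (t : ℂ) : ev t (0 : ι → ℂ[X]) = 0 := by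
  funext e; simp

omit [DecidableEq ι] in
/-- `linearIndependent_κ` — helper of this port (see the module docstring for its role). (docstring added in the port) -/
theorem linearIndependent_κ : LinearIndependent ℂ[X] (κ K) := by
  rw [Fintype.linearIndependent_iff]
  intro g hg i
  apply Polynomial.funext
  intro t
  have h := congrArg (ev t) hg
  rw [ev_sum, ev_zero'] at h
  simp only [ev_smul_poly, ev_κ] at h
  have hb : LinearIndependent ℂ (fun i => ((Module.finBasis ℂ K) i : ι → ℂ)) :=
    (Module.finBasis ℂ K).linearIndependent.map' K.subtype (Submodule.ker_subtype K)
  have := Fintype.linearIndependent_iff.mp hb (fun i => (g i).eval t) h i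
  simpa using this

omit [DecidableEq ι] in
/-- `finrank_Kpoly` — helper of this port (see the module docstring for its role). (docstring added in the port) -/
theorem finrank_Kpoly : Module.finrank ℂ[X] (Kpoly K) = Module.finrank ℂ K := by
  rw [Kpoly, finrank_span_eq_card (linearIndependent_κ K), Fintype.card_fin]

omit [DecidableEq ι] in
/-- `ev_mem_of_mem_Kpoly` — helper of this port (see the module docstring for its role). (docstring added in the port) -/
theorem ev_mem_of_mem_Kpoly {q : ι → ℂ[X]} (hq : q ∈ Kpoly K) (t : ℂ) : ev t q ∈ K := by
  induction hq using Submodule.span_induction with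
  | mem x hx =>
    obtain ⟨i, rfl⟩ := hx
    rw [ev_κ]; exact ((Module.finBasis ℂ K) i).2
  | zero => rw [ev_zero']; exact K.zero_mem
  | add x y _ _ hx hy => rw [ev_add]; exact K.add_mem hx hy
  | smul g x _ hx => rw [ev_smul_poly]; exact K.smul_mem _ hx

omit [DecidableEq ι] in
/-- `const_mem_Kpoly` — helper of this port (see the module docstring for its role). (docstring added in the port) -/
theorem const_mem_Kpoly {k : ι → ℂ} (hk : k ∈ K) : (fun e => Polynomial.C (k e)) ∈ Kpoly K := by
  set b := Module.finBasis ℂ K with hb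
  set r := b.repr ⟨k, hk⟩ with hr
  have hk' : k = ∑ i, r i • (b i : ι → ℂ) := by
    have := congrArg Subtype.val (b.sum_repr ⟨k, hk⟩)
    simp only [AddSubmonoidClass.coe_finsetSum, SetLike.val_smul] at this
    exact this.symm
  have hke : ∀ e, k e = ∑ i, r i * (b i : ι → ℂ) e := by
    intro e
    have := congrFun hk' e
    simpa [Finset.sum_apply] using this
  have hfun : (fun e => Polynomial.C (k e)) = ∑ i, Polynomial.C (r i) • κ K i := by
    funext e
    rw [hke e, map_sum, Finset.sum_apply]
    refine Finset.sum_congr rfl fun i _ => ?_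
    rw [Pi.smul_apply, smul_eq_mul, map_mul, κ]
  rw [hfun]
  exact Submodule.sum_mem _ fun i _ => Submodule.smul_mem _ _ (Submodule.subset_span ⟨i, rfl⟩)

/-- The algebraic family `N = Φ (K[s])`, `N_t = exp (A/t) K` for `t ≠ 0`. -/
noncomputable def Nfam (A : Matrix ι ι ℂ) (D : ℕ) : Submodule ℂ[X] (ι → ℂ[X]) := (Kpoly K).map (Matrix.toLin' (Φm A D))

variable {K}

/-- `mem_Nfam_iff` — helper of this port (see the module docstring for its role). (docstring added in the port) -/
theorem mem_Nfam_iff {A : Matrix ι ι ℂ} {D : ℕ} {p : ι → ℂ[X]} : p ∈ Nfam K A D ↔ ∃ q ∈ Kpoly K, Φm A D *ᵥ q = p := by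
  simp [Nfam, Submodule.mem_map, Matrix.toLin'_apply]

/-- `finrank_Nfam` — helper of this port (see the module docstring for its role). (docstring added in the port) -/
theorem finrank_Nfam {A : Matrix ι ι ℂ} {D : ℕ} (hA : A ^ (D + 1) = 0) :
    Module.finrank ℂ[X] (Nfam K A D) = Module.finrank ℂ K := by
  have hinj : Function.Injective (Matrix.toLin' (Φm A D)) := by
    intro q q' h
    have h' : Φm A D *ᵥ (q - q') = 0 := by
      rw [Matrix.mulVec_sub, ← Matrix.toLin'_apply, ← Matrix.toLin'_apply, h, sub_self]
    exact sub_eq_zero.mp (Φm_mulVec_injective hA h')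
  rw [Nfam, LinearEquiv.finrank_eq (Submodule.equivMapOfInjective _ hinj (Kpoly K)).symm, finrank_Kpoly]

/-- `ev_Nfam` — helper of this port (see the module docstring for its role). (docstring added in the port) -/
theorem ev_Nfam {A : Matrix ι ι ℂ} {D : ℕ} (hA : A ^ (D + 1) = 0) {p : ι → ℂ[X]} (hp : p ∈ Nfam K A D) {t : ℂ} (ht : t ≠ 0) :
    ∃ k ∈ K, ev t p = IsNilpotent.exp (t⁻¹ • A) *ᵥ k := by
  obtain ⟨q, hq, rfl⟩ := mem_Nfam_iff.mp hp
  refine ⟨t ^ D • ev t q, K.smul_mem _ (ev_mem_of_mem_Kpoly K hq t), ?_⟩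
  rw [ev_Φm_mulVec hA ht, Matrix.mulVec_smul]

/-- `exp_mulVec_mem_ev_Nfam` — helper of this port (see the module docstring for its role). (docstring added in the port) -/
theorem exp_mulVec_mem_ev_Nfam {A : Matrix ι ι ℂ} {D : ℕ} (hA : A ^ (D + 1) = 0) {t : ℂ} (ht : t ≠ 0) {k : ι → ℂ} (hk : k ∈ K) :
    ∃ p ∈ Nfam K A D, ev t p = IsNilpotent.exp (t⁻¹ • A) *ᵥ k := by
  refine ⟨Φm A D *ᵥ (fun e => Polynomial.C (((t ^ D)⁻¹ • k) e)),
    mem_Nfam_iff.mpr ⟨_, const_mem_Kpoly K (K.smul_mem _ hk), rfl⟩, ?_⟩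
  rw [ev_Φm_mulVec hA ht]
  have : ev t (fun e => Polynomial.C (((t ^ D)⁻¹ • k) e)) = (t ^ D)⁻¹ • k := by funext e; simp
  rw [this, Matrix.mulVec_smul, smul_smul, mul_inv_cancel₀ (pow_ne_zero _ ht), one_smul]

/-- Initial vectors of `N`: if `s^C · w ∈ N` then `ev_t w ∈ exp(A/t) K` for every `t ≠ 0`. -/
theorem ev_sat_mem {A : Matrix ι ι ℂ} {D : ℕ} (hA : A ^ (D + 1) = 0) {w : ι → ℂ[X]} {C : ℕ}
    (hwN : ((Polynomial.X : ℂ[X]) ^ C) • w ∈ Nfam K A D) {t : ℂ} (ht : t ≠ 0) :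
    ∃ k ∈ K, ev t w = IsNilpotent.exp (t⁻¹ • A) *ᵥ k := by
  obtain ⟨k, hk, hk'⟩ := ev_Nfam hA hwN ht
  refine ⟨(t ^ C)⁻¹ • k, K.smul_mem _ hk, ?_⟩
  have h1 : ev t (((Polynomial.X : ℂ[X]) ^ C) • w) = t ^ C • ev t w := by
    rw [ev_smul_poly, Polynomial.eval_pow, Polynomial.eval_X]
  rw [Matrix.mulVec_smul, ← hk', h1, smul_smul, inv_mul_cancel₀ (pow_ne_zero _ ht), one_smul]

/-- A linear map `G` with `G A = c · A G` intertwines the exponentials: `G · exp(xA) = exp(xc·A) · G`. -/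
theorem mul_exp_smul_of_rel {A G : Matrix ι ι ℂ} {c : ℂ} (h : G * A = c • (A * G)) {N : ℕ} (hA : A ^ N = 0) (x : ℂ) :
    G * IsNilpotent.exp (x • A) = IsNilpotent.exp ((x * c) • A) * G := by
  have hpow : ∀ i : ℕ, G * A ^ i = c ^ i • (A ^ i * G) := by
    intro i
    induction i with
    | zero => simp
    | succ i ih =>
      rw [pow_succ, ← Matrix.mul_assoc, ih, Matrix.smul_mul, Matrix.mul_assoc, h, Matrix.mul_smul, smul_smul, ← Matrix.mul_assoc,
        ← pow_succ, pow_succ, mul_comm (c ^ i) c]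
  rw [exp_smul_eq_sum' hA x, exp_smul_eq_sum' hA (x * c), Finset.mul_sum, Finset.sum_mul]
  refine Finset.sum_congr rfl fun i _ => ?_
  rw [Matrix.mul_smul, Matrix.mul_smul, hpow i, Matrix.smul_mul, Matrix.smul_mul, smul_smul, smul_smul, smul_smul, mul_pow]
  ring_nf

/-- Scaling reparametrisation `s ↦ c·s` of a polynomial vector. -/
noncomputable def scl (c : ℂ) (w : ι → ℂ[X]) : ι → ℂ[X] := fun e => (w e).comp (Polynomial.C c * Polynomial.X)

omit [Fintype ι] [DecidableEq ι] in
/-- `ev_scl` — helper of this port (see the module docstring for its role). (docstring added in the port) -/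
theorem ev_scl (c t : ℂ) (w : ι → ℂ[X]) : ev t (scl c w) = ev (c * t) w := by
  funext e; simp [scl, Polynomial.eval_comp]

end Summit.ValiantsHypothesis.ValiantsHypothesis.Theorems.GrenetZeon.InitialForm.UnipotentClosure
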